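import Mathlib
import Summits.KontsevichZagierPeriods.Zeta5Search.RecordCellDProof
import Summits.KontsevichZagierPeriods.Zeta5Search.UniversalDigitCells
import HarnessLib

/-!
# ζ(5) search — the CLASS-STRUCTURE LEMMA of cell D and gen-2 g9's `RecordCellDClassData` / `RecordCellDBonus` BY NAME

Cell `pub-zeta5` (HONEST FRAMING: systematic search; no irrationality claim unless certified), P1 prover seat
generation 6.  gen-2 g9 typed the class structure of the record cell D (`7n < p < 7.5n` on `b(n) = n·(41;17,…,11)`) as
`ClusterValuation.RecordCellDClassData` (REPORT-gen2-g9 §8, certified there for all `n` by face enumeration) and the LB♯♯ bonus as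
`RecordCellDBonus` (`casLB + 1 ≤ v_p(Cas₇)`).  Both are THEOREMS here: the class data from the atlas `RecordCellDAtlas{,NotMin}`
(minimal classes `MinT1 ∪ MinS ∪ MinT2`, three poles each, `E = −8`; every other class `E ≥ −7`; the affine witness
`x = 27n − 3p ∈ MinT1`), the value **`casLB (bRec n) p = −13`** by reading the `List.min?` definitions (`VB = −8`, `rowMin = −5`), and the
bonus from `CellD.recordCellD` (`v_p(Cas₇) ≥ −12 = casLB + 1`).  Exact arithmetic; nothing about irrationality.
-/

open Finset

namespace Summit.KontsevichZagierPeriods.Zeta5Search.CellD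

open Summit.KontsevichZagierPeriods.Zeta5Search.WedgeDictionary (dOf)
open Summit.KontsevichZagierPeriods.Zeta5Search.CasoratianValuation (InPolytope shift casoratian)
open Summit.KontsevichZagierPeriods.Zeta5Search.ClusterValuation
open Summit.KontsevichZagierPeriods.Zeta5Search.CellA (bRec_zero bRec_zero_toNat classExp_le_classNu)
open Summit.KontsevichZagierPeriods.Zeta5Search.LevelClass

/-! ### §1 Pole counts and class exponents of the minimal classes -/

/-- The pole count of a level class is the number of negative entries of its type. -/
theorem classPoleCount_level {p : ℕ} [hp : Fact p.Prime] (b : ℕ → ℤ) {x L : ℕ} (hx : x < p) (hL : x + L * p ≤ (b 0).toNat)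
    (hL' : (b 0).toNat < x + L * p + p) (e : ℕ → ℤ) (he : ∀ k ≤ L, netExp b (x + k * p) = e k) :
    classPoleCount b p x = ((range (L + 1)).filter fun k => e k < 0).card := by
  have : classPoleCount b p x = (CellA.classPoles b p x).card := rfl
  rw [this, classPoles_level b hx hL hL' e he, card_image_of_injective _ (level_injective hp.out.pos x)]

section MinData

variable {n p : ℕ} (hp14 : 14 * n < 2 * p) (hp15 : 2 * p < 15 * n) (hprime : p.Prime)

include hp14 hp15 hprime in
/-- A class of `MinT1`: three poles, class exponent `−8`. -/
theorem data_minT1 {x : ℕ} (hx : x ∈ MinT1 n p) : classPoleCount (bRec n) p x = 3 ∧ classExp (bRec n) p x = -8 := by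
  haveI : Fact p.Prime := ⟨hprime⟩
  obtain ⟨⟨e0, e1, e2, e3, e4⟩, -, hxp, h4, h5, hc4, hc5⟩ := netExp_minT1 hp14 hp15 hx
  have hL : x + 4 * p ≤ (bRec n 0).toNat := by rw [bRec_zero_toNat]; exact h4
  have hL' : (bRec n 0).toNat < x + 4 * p + p := by rw [bRec_zero_toNat]; omega
  have he := he_of_five (e := eT1) e0 e1 e2 e3 e4
  refine ⟨?_, ?_⟩
  · rw [classPoleCount_level (bRec n) hxp hL hL' eT1 he]; decide
  · rw [classExp_level (bRec n) hxp hL hL' eT1 he (not_centreIn hp14 hp15 hxp hc4 hc5)]; exact typeExp_eT1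

include hp14 hp15 hprime in
/-- A class of `MinS`: three poles, class exponent `−8`. -/
theorem data_minS {x : ℕ} (hx : x ∈ MinS n p) : classPoleCount (bRec n) p x = 3 ∧ classExp (bRec n) p x = -8 := by
  haveI : Fact p.Prime := ⟨hprime⟩
  obtain ⟨⟨e0, e1, e2, e3, e4⟩, -, hxp, h4, h5, hc4, hc5⟩ := netExp_minS hp14 hp15 hx
  have hL : x + 4 * p ≤ (bRec n 0).toNat := by rw [bRec_zero_toNat]; exact h4
  have hL' : (bRec n 0).toNat < x + 4 * p + p := by rw [bRec_zero_toNat]; omega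
  have he := he_of_five (e := eS) e0 e1 e2 e3 e4
  refine ⟨?_, ?_⟩
  · rw [classPoleCount_level (bRec n) hxp hL hL' eS he]; decide
  · rw [classExp_level (bRec n) hxp hL hL' eS he (not_centreIn hp14 hp15 hxp hc4 hc5)]; exact typeExp_eS

include hp14 hp15 hprime in
/-- A class of `MinT2`: three poles, class exponent `−8`. -/
theorem data_minT2 {x : ℕ} (hx : x ∈ MinT2 n p) : classPoleCount (bRec n) p x = 3 ∧ classExp (bRec n) p x = -8 := by
  haveI : Fact p.Prime := ⟨hprime⟩
  obtain ⟨⟨e0, e1, e2, e3, e4⟩, -, hxp, h4, h5, hc4, hc5⟩ := netExp_minT2 hp14 hp15 hx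
  have hL : x + 4 * p ≤ (bRec n 0).toNat := by rw [bRec_zero_toNat]; exact h4
  have hL' : (bRec n 0).toNat < x + 4 * p + p := by rw [bRec_zero_toNat]; omega
  have he := he_of_five (e := eT2) e0 e1 e2 e3 e4
  refine ⟨?_, ?_⟩
  · rw [classPoleCount_level (bRec n) hxp hL hL' eT2 he]; decide
  · rw [classExp_level (bRec n) hxp hL hL' eT2 he (not_centreIn hp14 hp15 hxp hc4 hc5)]; exact typeExp_eT2

include hp14 hp15 hprime in
/-- **Every class of the cell has `E_x ≥ −8`**, with equality exactly on `MinT1 ∪ MinS ∪ MinT2`. -/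
theorem classExp_ge_neg8 {x : ℕ} (hx : x < p) : -8 ≤ classExp (bRec n) p x ∧ (classExp (bRec n) p x = -8 → x ∈ MinAll n p) := by
  by_cases h1 : x ∈ MinT1 n p
  · exact ⟨le_of_eq (data_minT1 hp14 hp15 hprime h1).2.symm, fun _ => by simp [MinAll, h1]⟩
  by_cases h2 : x ∈ MinS n p
  · exact ⟨le_of_eq (data_minS hp14 hp15 hprime h2).2.symm, fun _ => by simp [MinAll, h2]⟩
  by_cases h3 : x ∈ MinT2 n p
  · exact ⟨le_of_eq (data_minT2 hp14 hp15 hprime h3).2.symm, fun _ => by simp [MinAll, h3]⟩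
  have h := classExp_ge_of_notMin hp14 hp15 hx h1 h2 h3
  exact ⟨by omega, fun hE => by omega⟩

include hp14 hp15 in
/-- **The affine witness (D5w)**: `x = 27n − 3p`, the class of the order-3 point `27n`, lies in `MinT1`. -/
theorem witness_mem_minT1 : 27 * n - 3 * p ∈ MinT1 n p := by
  rw [mem_minT1]; omega

end MinData

/-! ### §2 `casLB = −13` on the cell -/

/-- **`casLB (bRec n) p = −13`** for `14n < 2p < 15n`: `VB = −8` (attained on `MinT1`, every pole class has `ν ≥ E ≥ −8`) and
`rowMin = 3 + (−8) = −5` (single-pole rows give `1`, the excess row is absent or `0`). -/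
theorem casLB_bRecD {n p : ℕ} (hp14 : 14 * n < 2 * p) (hp15 : 2 * p < 15 * n) (hprime : p.Prime) : casLB (bRec n) p = -13 := by
  set x₀ := 27 * n - 3 * p with hx₀
  have hx₀m : x₀ ∈ MinT1 n p := witness_mem_minT1 hp14 hp15
  have hx₀p : x₀ < p := (mem_minT1.1 hx₀m).1
  obtain ⟨hcnt, hE⟩ := data_minT1 hp14 hp15 hprime hx₀m
  have hpole : 1 ≤ classPoleCount (bRec n) p x₀ := by omega
  obtain ⟨v, hv⟩ := vbMin_isSome (bRec n) hx₀p hpole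
  obtain ⟨r, hr⟩ := rowMin_isSome (bRec n) hx₀p hpole
  have hLB : casLB (bRec n) p = v + r := by simp [casLB, hv, hr]
  have hν₀ : classNu (bRec n) p x₀ = -8 := by
    unfold classNu; rw [if_neg (by omega), hE]
  -- upper bounds
  have hv1 : v ≤ -8 := by have := vbMin_le (bRec n) hv hx₀p hpole; rwa [hν₀] at this
  have hr1 : r ≤ -5 := by have := rowMin_le_multi (bRec n) hr hx₀p (by omega); rwa [hE] at this
  -- lower bounds: `v` and `r` are attained
  have hv2 : -8 ≤ v := by
    obtain ⟨hmem, -⟩ := List.min?_eq_some_iff.1 hv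
    obtain ⟨y, hy, rfl⟩ := List.mem_map.1 hmem
    obtain ⟨hyp, -⟩ := List.mem_filter.1 hy
    rw [List.mem_range] at hyp
    exact (classExp_ge_neg8 hp14 hp15 hprime hyp).1.trans (classExp_le_classNu _ _ _)
  have hr2 : -5 ≤ r := by
    obtain ⟨hmem, -⟩ := List.min?_eq_some_iff.1 hr
    rcases List.mem_append.1 hmem with h | h
    · obtain ⟨y, hy, hz⟩ := List.mem_filterMap.1 h
      rw [List.mem_range] at hy
      by_cases hc1 : classPoleCount (bRec n) p y = 1
      · rw [if_pos hc1] at hz; simp at hz; omega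
      · rw [if_neg hc1] at hz
        by_cases hc2 : 2 ≤ classPoleCount (bRec n) p y
        · rw [if_pos hc2] at hz
          simp at hz
          have := (classExp_ge_neg8 hp14 hp15 hprime hy).1
          omega
        · rw [if_neg hc2] at hz; simp at hz
    · split_ifs at h with hd
      · simp at h; omega
      · simp at h
  omega

/-! ### §3 gen-2 g9's two statements, by name -/

/-- **`ClusterValuation.RecordCellDClassData` (gen-2 g9, REPORT §8) is a THEOREM.** -/
theorem recordCellDClassData_holds : RecordCellDClassData := by
  intro n p hn2 hprime hp14 hp15
  have hn : 1 ≤ n := by omega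
  refine ⟨casLB_bRecD hp14 hp15 hprime, fun x hx => (classExp_ge_neg8 hp14 hp15 hprime hx).1, fun x hx hc1 => ?_, ⟨?_, ?_⟩,
    fun x hx hE => ?_⟩
  · -- single-pole classes are not minimal
    obtain ⟨hge, hmin⟩ := classExp_ge_neg8 hp14 hp15 hprime hx
    have hnot : x ∉ MinAll n p := by
      intro hm
      rw [MinAll, mem_union, mem_union] at hm
      rcases hm with (h | h) | h
      · have := (data_minT1 hp14 hp15 hprime h).1; omega
      · have := (data_minS hp14 hp15 hprime h).1; omega
      · have := (data_minT2 hp14 hp15 hprime h).1; omega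
    have h7 : -7 ≤ classExp (bRec n) p x := by
      by_contra hlt; exact hnot (hmin (by omega))
    exact h7.trans (classExp_le_classNu _ _ _)
  · rw [multipoleClasses, mem_filter, mem_range]
    have hm := witness_mem_minT1 (n := n) hp14 hp15
    exact ⟨(mem_minT1.1 hm).1, by have := (data_minT1 hp14 hp15 hprime hm).1; omega⟩
  · exact (data_minT1 hp14 hp15 hprime (witness_mem_minT1 hp14 hp15)).2
  · have hm := (classExp_ge_neg8 hp14 hp15 hprime hx).2 hE
    have hmult : x ∈ multipoleClasses (bRec n) p := by
      rw [multipoleClasses, mem_filter, mem_range]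
      refine ⟨hx, ?_⟩
      rw [MinAll, mem_union, mem_union] at hm
      rcases hm with (h | h) | h
      · have := (data_minT1 hp14 hp15 hprime h).1; omega
      · have := (data_minS hp14 hp15 hprime h).1; omega
      · have := (data_minT2 hp14 hp15 hprime h).1; omega
    have hcs : classSet (bRec n) p x = {x, x + p, x + 2 * p, x + 3 * p, x + 4 * p} := by
      rw [classSet_bRecD hp14 hp15 hx, if_neg ?_]
      rw [MinAll, mem_union, mem_union, mem_minT1, mem_minS, mem_minT2] at hm
      omega
    have h11 : 11 * n ∉ classSet (bRec n) p x := by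
      rw [hcs]; simp only [mem_insert, mem_singleton]
      rw [MinAll, mem_union, mem_union, mem_minT1, mem_minS, mem_minT2] at hm
      omega
    have h30 : 30 * n ∉ classSet (bRec n) p x := by
      rw [hcs]; simp only [mem_insert, mem_singleton]
      rw [MinAll, mem_union, mem_union, mem_minT1, mem_minS, mem_minT2] at hm
      omega
    rw [MinAll, mem_union, mem_union] at hm
    rcases hm with (h | h) | h
    · obtain ⟨hex, -, -, -, -, hc4, hc5⟩ := netExp_minT1 hp14 hp15 h
      exact ⟨not_centreIn hp14 hp15 hx hc4 hc5, hmult, h11, h30, Or.inl ⟨hcs, Or.inl hex⟩⟩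
    · obtain ⟨hex, -, -, -, -, hc4, hc5⟩ := netExp_minS hp14 hp15 h
      exact ⟨not_centreIn hp14 hp15 hx hc4 hc5, hmult, h11, h30, Or.inl ⟨hcs, Or.inr (Or.inr hex)⟩⟩
    · obtain ⟨hex, -, -, -, -, hc4, hc5⟩ := netExp_minT2 hp14 hp15 h
      exact ⟨not_centreIn hp14 hp15 hx hc4 hc5, hmult, h11, h30, Or.inl ⟨hcs, Or.inr (Or.inl hex)⟩⟩

/-- **`ClusterValuation.RecordCellDBonus` (gen-2 g9) is a THEOREM**: `casLB + 1 = −12 ≤ v_p(Cas₇(b(n)))` on the cell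
(`casLB_bRecD` + `recordCellD`). -/
theorem recordCellDBonus_holds : RecordCellDBonus := by
  intro n p hn2 hprime hp14 hp15 hne
  rw [casLB_bRecD hp14 hp15 hprime]
  have := recordCellD n p hn2 hprime hp14 hp15 hne
  push_cast
  linarith

end Summit.KontsevichZagierPeriods.Zeta5Search.CellD
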